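import Literature.Barriers.BirchSwinnertonDyer.PAdicFunctionalEquationParity
import HarnessLib

/-!
# Λ^ι-scaling and averaging for the X8 pair functional equation (crux-ideate seat 1 g36 — a REMARK, not a line)

Crux `SignedLowerHalves.SprungLowerDivisibilityAtThree` (stmt-BirchSwinnertonDyer-19875) is NOT proved or restated here.
This file answers `Lines/chromatic-common-zeros-IOTA2-w3g5.md` §3 (2) («a curve-free `(L♯, L♭)` satisfying the pair FE
shape WITH an ι-paired sporadic zero of `L♭` — to confirm the residue is not void for algebraic reasons»):

* `PairFE.smul` — the solution set of the pair functional equation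
  `κ′·L♯(T^ι) = m₀₀ L♯ + c₀₁ L♭`, `κ′·L♭(T^ι) = c₁₀ L♯ + m₁₁ L♭` (shape of
  `Theorems.ChromaticIota.ClassX8.exists_pair_functionalEquation`, coefficients free) is a module over the
  fixed ring `Λ^ι = {s | s(T^ι) = s}`;
* `subst_mul_subst_self` — `s := f · f(T^ι) ∈ Λ^ι` for every `f`; with `subst_X_sub_C` (`ι` carries `T − a` to a
  unit multiple of `T − a′`, `(1+a)(1+a′) = 1`) the scalar `s = (T − a)·(T − a)(T^ι)` plants the ι-PAIRED zero
  `{a, a′}` in BOTH colours of ANY solution (`PairFE.exists_iotaPaired`), e.g. `a = 3`, `a′ = −3/4` over `ℤ₃`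
  (`example` below: `4 ∈ ℤ₃ˣ`), a sporadic pair (`μ(s) = 0`, `λ(s) = 2`, `s(0) = 9 ≠ 0`);
* `pairFE_average` — curve-free solutions: if the coefficient matrix satisfies the cocycle identities
  `M·M(T^ι) = κ′κ′(T^ι)·I` (for the tree's normalisation: `M` = the unique half-logarithm transition matrix,
  `κ′ = (σ(1+T)^c)(T^ι)`, `σ² = 1` — to be read off `halfLogMatrix_transition_unique`; NOT proved here), then for EVERY
  `w = (x, y) ∈ Λ²` the ι-average `κ′κ′(T^ι)·w + κ′·M(T^ι)·w(T^ι)` is a solution.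

Consequence recorded in `Seat1G36-IotaScaling.md`: every class-wide structure of the ι-lane that is homogeneous under
Λ^ι-scaling (pair FE, transition matrix, ι-stability, mod-3 one-colour FE, `λ♯ ≡ λ♭ (2)`, order trichotomy at `T = 0`,
cyclotomic pairing, `μ = 0` of a colour, non-vanishing) is shared by pairs WITH ι-paired sporadic common zeros; only
Λ^ι-INHOMOGENEOUS input (interpolated values / digits, the `T = 0` leading term, Kato's divisibility, smallness of `λ`) can
bear on `stub_katoFineLowerSporadic` / `stub_cyclotomicLowerPosLevel`. Pair version of the catalogued barrier
`Literature.Barriers.BirchSwinnertonDyer.PAdicFunctionalEquationSeesOnlyParity`.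
-/

noncomputable section

open PowerSeries Literature.Barriers.BirchSwinnertonDyer

namespace Summit.BirchSwinnertonDyer.BirchSwinnertonDyer.Cruxes.SprungLowerDivisibilityAtThree.IotaScaling

/-! ## 1. Abstract part: a ring with an involution `φ` -/

section Abstract

variable {A : Type*} [CommRing A] (φ : A →+* A)

/-- The pair functional-equation shape with free coefficients: `k·φ x = m₀₀ x + c₀₁ y ∧ k·φ y = c₁₀ x + m₁₁ y`. -/
def PairFEφ (k m₀₀ c₀₁ c₁₀ m₁₁ x y : A) : Prop :=
  k * φ x = m₀₀ * x + c₀₁ * y ∧ k * φ y = c₁₀ * x + m₁₁ * y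

/-- **Λ^φ-linearity.** A `φ`-invariant scalar carries solutions to solutions. [folklore] -/
theorem PairFEφ.smul {k m₀₀ c₀₁ c₁₀ m₁₁ x y : A} (h : PairFEφ φ k m₀₀ c₀₁ c₁₀ m₁₁ x y) {s : A}
    (hs : φ s = s) : PairFEφ φ k m₀₀ c₀₁ c₁₀ m₁₁ (s * x) (s * y) := by
  obtain ⟨h1, h2⟩ := h
  refine ⟨?_, ?_⟩
  · rw [map_mul, hs]
    linear_combination s * h1
  · rw [map_mul, hs]
    linear_combination s * h2

/-- Solutions form an additive group as well (so a `Λ^φ`-module). [folklore] -/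
theorem PairFEφ.add {k m₀₀ c₀₁ c₁₀ m₁₁ x y x' y' : A} (h : PairFEφ φ k m₀₀ c₀₁ c₁₀ m₁₁ x y)
    (h' : PairFEφ φ k m₀₀ c₀₁ c₁₀ m₁₁ x' y') : PairFEφ φ k m₀₀ c₀₁ c₁₀ m₁₁ (x + x') (y + y') := by
  obtain ⟨h1, h2⟩ := h
  obtain ⟨h1', h2'⟩ := h'
  refine ⟨?_, ?_⟩
  · rw [map_add]
    linear_combination h1 + h1'
  · rw [map_add]
    linear_combination h2 + h2'

/-- `s := f · φ f` is `φ`-invariant when `φ` is an involution. [folklore] -/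
theorem mul_map_self_invariant (hφ : ∀ a, φ (φ a) = a) (f : A) : φ (f * φ f) = f * φ f := by
  rw [map_mul, hφ, mul_comm]

/-- **Curve-free solutions by ι-averaging.** Under the cocycle identities `M·φ(M) = k·φ(k)·I` the vector
`k φ(k)·w + k·φ(M)·φ(w)` solves the pair functional equation for EVERY `w = (x, y)`. [folklore] -/
theorem pairFE_average (hφ : ∀ a, φ (φ a) = a) {k m₀₀ c₀₁ c₁₀ m₁₁ : A}
    (h₀₀ : m₀₀ * φ m₀₀ + c₀₁ * φ c₁₀ = k * φ k) (h₀₁ : m₀₀ * φ c₀₁ + c₀₁ * φ m₁₁ = 0)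
    (h₁₀ : c₁₀ * φ m₀₀ + m₁₁ * φ c₁₀ = 0) (h₁₁ : c₁₀ * φ c₀₁ + m₁₁ * φ m₁₁ = k * φ k)
    (x y x' y' : A) (hx' : x' = k * φ k * x + k * (φ m₀₀ * φ x + φ c₀₁ * φ y))
    (hy' : y' = k * φ k * y + k * (φ c₁₀ * φ x + φ m₁₁ * φ y)) :
    PairFEφ φ k m₀₀ c₀₁ c₁₀ m₁₁ x' y' := by
  subst hx' hy'
  refine ⟨?_, ?_⟩
  · simp only [map_add, map_mul, hφ]
    linear_combination (-(k * φ x)) * h₀₀ - (k * φ y) * h₀₁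
  · simp only [map_add, map_mul, hφ]
    linear_combination (-(k * φ x)) * h₁₀ - (k * φ y) * h₁₁

end Abstract

/-! ## 2. The involution `ι : T ↦ (1+T)⁻¹ − 1` of `R⟦T⟧` -/

section Iota

variable {R : Type*} [CommRing R]

/-- `g ↦ g(T^ι)` as a ring endomorphism of `R⟦T⟧`. -/
def iotaHom : R⟦X⟧ →+* R⟦X⟧ := (substAlgHom (hasSubst_invOnePlusSubOne (R := R))).toRingHom

theorem iotaHom_apply (g : R⟦X⟧) : iotaHom g = PowerSeries.subst (invOnePlusSubOne : R⟦X⟧) g := by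
  rw [iotaHom, AlgHom.toRingHom_eq_coe, RingHom.coe_coe, coe_substAlgHom]

/-- `ι ∘ ι = id`. [folklore] -/
theorem iotaHom_iotaHom [IsDomain R] (g : R⟦X⟧) : iotaHom (iotaHom g) = g := by
  have hι := hasSubst_invOnePlusSubOne (R := R)
  rw [iotaHom_apply, iotaHom_apply, subst_comp_subst_apply hι hι, invOnePlusSubOne_subst_self, X_subst]

/-- The pair FE of the tree, coefficients free:
`κ′·L♯(T^ι) = m₀₀ L♯ + c₀₁ L♭ ∧ κ′·L♭(T^ι) = c₁₀ L♯ + m₁₁ L♭`. -/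
def PairFE (κ' m₀₀ c₀₁ c₁₀ m₁₁ Ls Lf : R⟦X⟧) : Prop :=
  κ' * PowerSeries.subst (invOnePlusSubOne : R⟦X⟧) Ls = m₀₀ * Ls + c₀₁ * Lf ∧
    κ' * PowerSeries.subst (invOnePlusSubOne : R⟦X⟧) Lf = c₁₀ * Ls + m₁₁ * Lf

theorem pairFE_iff (κ' m₀₀ c₀₁ c₁₀ m₁₁ Ls Lf : R⟦X⟧) :
    PairFE κ' m₀₀ c₀₁ c₁₀ m₁₁ Ls Lf ↔ PairFEφ iotaHom κ' m₀₀ c₀₁ c₁₀ m₁₁ Ls Lf := by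
  simp only [PairFE, PairFEφ, iotaHom_apply]

/-- **Λ^ι-SCALING.** If `(L♯, L♭)` satisfies the pair FE and `s(T^ι) = s`, so does `(s L♯, s L♭)` — same `κ′`, same `M`. [folklore] -/
theorem PairFE.smul {κ' m₀₀ c₀₁ c₁₀ m₁₁ Ls Lf : R⟦X⟧} (h : PairFE κ' m₀₀ c₀₁ c₁₀ m₁₁ Ls Lf) {s : R⟦X⟧}
    (hs : PowerSeries.subst (invOnePlusSubOne : R⟦X⟧) s = s) : PairFE κ' m₀₀ c₀₁ c₁₀ m₁₁ (s * Ls) (s * Lf) := by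
  obtain ⟨h1, h2⟩ := h
  have hι := hasSubst_invOnePlusSubOne (R := R)
  refine ⟨?_, ?_⟩
  · rw [subst_mul hι, hs]
    linear_combination s * h1
  · rw [subst_mul hι, hs]
    linear_combination s * h2

/-- `s := f · f(T^ι)` is ι-invariant. [folklore] -/
theorem subst_mul_subst_self [IsDomain R] (f : R⟦X⟧) :
    PowerSeries.subst (invOnePlusSubOne : R⟦X⟧) (f * PowerSeries.subst (invOnePlusSubOne : R⟦X⟧) f) =
      f * PowerSeries.subst (invOnePlusSubOne : R⟦X⟧) f := by
  have h := mul_map_self_invariant iotaHom iotaHom_iotaHom f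
  simpa only [iotaHom_apply] using h

/-- `ι` carries `T − a` to a unit multiple of `T − a′` when `(1+a)(1+a′) = 1`:
`(T − a)(T^ι) = −(1 + a)(1 + T^ι)·(T − a′)`. [cite: GreenbergLNM1716, §1] -/
theorem subst_X_sub_C {a a' : R} (haa' : (1 + a) * (1 + a') = 1) :
    PowerSeries.subst (invOnePlusSubOne : R⟦X⟧) (X - C a : R⟦X⟧) =
      -((1 + C a) * (invOnePlusSubOne + 1)) * (X - C a') := by
  have hι := hasSubst_invOnePlusSubOne (R := R)
  have hE : (1 + X : R⟦X⟧) * (invOnePlusSubOne + 1) = 1 := one_add_X_mul_invOnePlusSubOne_add_one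
  have hCa : PowerSeries.subst (invOnePlusSubOne : R⟦X⟧) (C a : R⟦X⟧) = C a := by
    rw [← coe_substAlgHom hι, C_eq_algebraMap, AlgHom.commutes]
  have hC : ((1 : R⟦X⟧) + C a) * (1 + C a') = 1 := by
    have h := congrArg (C (R := R)) haa'
    simpa using h
  rw [subst_sub hι, subst_X hι, hCa]
  linear_combination ((1 : R⟦X⟧) + C a) * hE - (invOnePlusSubOne + 1 : R⟦X⟧) * hC

/-- **ι-PAIRED ZEROS ARE NOT EXCLUDED BY THE PAIR FE.** From ANY solution `(L♯, L♭)` and any `a, a′` with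
`(1+a)(1+a′) = 1`, the rescaled pair `(s L♯, s L♭)`, `s = (T − a)·(T − a)(T^ι)`, is again a solution (same `κ′`, `M`)
with BOTH colours in `(T − a) ∩ (T − a′)`; over a domain it is non-zero as soon as the colour was. [folklore] -/
theorem PairFE.exists_iotaPaired [IsDomain R] {κ' m₀₀ c₀₁ c₁₀ m₁₁ Ls Lf : R⟦X⟧}
    (h : PairFE κ' m₀₀ c₀₁ c₁₀ m₁₁ Ls Lf) {a a' : R} (haa' : (1 + a) * (1 + a') = 1) :
    ∃ s : R⟦X⟧, PowerSeries.subst (invOnePlusSubOne : R⟦X⟧) s = s ∧ s ≠ 0 ∧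
      PairFE κ' m₀₀ c₀₁ c₁₀ m₁₁ (s * Ls) (s * Lf) ∧
      s * Ls ∈ Ideal.span {(X - C a : R⟦X⟧)} ∧ s * Lf ∈ Ideal.span {(X - C a : R⟦X⟧)} ∧
      s * Ls ∈ Ideal.span {(X - C a' : R⟦X⟧)} ∧ s * Lf ∈ Ideal.span {(X - C a' : R⟦X⟧)} ∧
      (Ls ≠ 0 → s * Ls ≠ 0) ∧ (Lf ≠ 0 → s * Lf ≠ 0) := by
  set f : R⟦X⟧ := X - C a with hf
  set s : R⟦X⟧ := f * PowerSeries.subst (invOnePlusSubOne : R⟦X⟧) f with hsdef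
  have hs : PowerSeries.subst (invOnePlusSubOne : R⟦X⟧) s = s := subst_mul_subst_self f
  have hf0 : f ≠ 0 := by
    intro h0
    have h1 := congrArg (coeff 1) h0
    rw [hf, map_sub, coeff_one_X, coeff_C, if_neg one_ne_zero, sub_zero, map_zero] at h1
    exact one_ne_zero h1
  have hιf : PowerSeries.subst (invOnePlusSubOne : R⟦X⟧) f = -((1 + C a) * (invOnePlusSubOne + 1)) * (X - C a') :=
    subst_X_sub_C haa'
  have hιf0 : PowerSeries.subst (invOnePlusSubOne : R⟦X⟧) f ≠ 0 := by
    intro h0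
    have h1 := congrArg (PowerSeries.subst (invOnePlusSubOne : R⟦X⟧)) h0
    have hι := hasSubst_invOnePlusSubOne (R := R)
    rw [subst_comp_subst_apply hι hι, invOnePlusSubOne_subst_self, X_subst, ← coe_substAlgHom hι, map_zero] at h1
    exact hf0 h1
  have hs0 : s ≠ 0 := mul_ne_zero hf0 hιf0
  have hmem_a : ∀ L : R⟦X⟧, s * L ∈ Ideal.span {(X - C a : R⟦X⟧)} := fun L => by
    rw [hsdef, mul_assoc]
    exact Ideal.mul_mem_right _ _ (Ideal.subset_span rfl)
  have hmem_a' : ∀ L : R⟦X⟧, s * L ∈ Ideal.span {(X - C a' : R⟦X⟧)} := fun L => by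
    rw [hsdef, hιf, mul_comm f, mul_assoc, mul_assoc]
    exact Ideal.mul_mem_left _ _ (Ideal.mul_mem_right _ _ (Ideal.subset_span rfl))
  exact ⟨s, hs, hs0, h.smul hs, hmem_a Ls, hmem_a Lf, hmem_a' Ls, hmem_a' Lf,
    fun hL => mul_ne_zero hs0 hL, fun hL => mul_ne_zero hs0 hL⟩

/-- **Curve-free solutions of the tree's FE shape** (ι-averaging), under the cocycle identities for `(κ′, M)`. [folklore] -/
theorem PairFE.average [IsDomain R] {κ' m₀₀ c₀₁ c₁₀ m₁₁ : R⟦X⟧}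
    (h₀₀ : m₀₀ * iotaHom m₀₀ + c₀₁ * iotaHom c₁₀ = κ' * iotaHom κ')
    (h₀₁ : m₀₀ * iotaHom c₀₁ + c₀₁ * iotaHom m₁₁ = 0)
    (h₁₀ : c₁₀ * iotaHom m₀₀ + m₁₁ * iotaHom c₁₀ = 0)
    (h₁₁ : c₁₀ * iotaHom c₀₁ + m₁₁ * iotaHom m₁₁ = κ' * iotaHom κ') (x y : R⟦X⟧) :
    PairFE κ' m₀₀ c₀₁ c₁₀ m₁₁
      (κ' * iotaHom κ' * x + κ' * (iotaHom m₀₀ * iotaHom x + iotaHom c₀₁ * iotaHom y))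
      (κ' * iotaHom κ' * y + κ' * (iotaHom c₁₀ * iotaHom x + iotaHom m₁₁ * iotaHom y)) := by
  have hφ := iotaHom_iotaHom (R := R)
  refine ⟨?_, ?_⟩
  · rw [← iotaHom_apply]
    simp only [map_add, map_mul, hφ]
    linear_combination (-(κ' * iotaHom x)) * h₀₀ - (κ' * iotaHom y) * h₀₁
  · rw [← iotaHom_apply]
    simp only [map_add, map_mul, hφ]
    linear_combination (-(κ' * iotaHom x)) * h₁₀ - (κ' * iotaHom y) * h₁₁

end Iota

/-! ## 3. The sporadic partner pair `{3, −3/4}` over `ℤ₃` exists (`4 ∈ ℤ₃ˣ`). -/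

example : ∃ a' : ℤ_[3], (1 + (3 : ℤ_[3])) * (1 + a') = 1 := by
  have h4 : IsUnit ((4 : ℤ) : ℤ_[3]) := by
    rw [PadicInt.isUnit_iff]
    have h1 := PadicInt.norm_le_one ((4 : ℤ) : ℤ_[3])
    have h2 : ¬ ‖((4 : ℤ) : ℤ_[3])‖ < 1 := by
      rw [PadicInt.norm_int_lt_one_iff_dvd]
      norm_num
    exact le_antisymm h1 (not_lt.mp h2)
  obtain ⟨u, hu⟩ := h4
  refine ⟨(↑u⁻¹ : ℤ_[3]) - 1, ?_⟩
  have h14 : (1 + (3 : ℤ_[3])) = (u : ℤ_[3]) := by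
    rw [hu]; push_cast; norm_num
  rw [h14, add_sub_cancel, Units.mul_inv]

end Summit.BirchSwinnertonDyer.BirchSwinnertonDyer.Cruxes.SprungLowerDivisibilityAtThree.IotaScaling

end
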